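import Literature.Analysis.FluidPDE.Tao2016AveragedNS.SplitCascadeRescaledEnergy
import Literature.Analysis.FluidPDE.TaoCascadeZeroScaleSetup
import HarnessLib

/-!
# The split Prop. 6.5, §6.7: the setting of the zero-scale bootstrap with the asymmetry absorbed (layer 4 of the port)

T. Tao, *Finite time blowup for an averaged three-dimensional Navier–Stokes equation*,
J. Amer. Math. Soc. 29 (2016), 601–674 = arXiv:1402.0290v3, §6.5–§6.7. HONEST FRAMING: statements
about the SPLIT cascade model system; nothing here proves the split Prop. 6.5 and nothing here
concerns the true Navier–Stokes equations.

Split counterpart of `TaoCascadeZeroScaleSetup.lean`. THE DESIGN POINT OF THE PORT: the standing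
hypotheses of §6.7 for the split system are bundled as `Tao2016AveragedNS.ZeroScale.Context` with
(a) the split rescaled hypotheses `RescaledSplitHypotheses` carried with HALF the error constant,
`C₁/2`, (b) a pointwise asymmetry certificate on the window, `|Z̃_{i,k}(t)| ≤ ζ` for `k ∈ {-1,0,1}`,
`t ∈ [0,T]` (in the assembly: from the profile clauses at the checkpoint by the channel lemmas of
`SplitCascadeRescaledChannels.lean`), and (c) ONE master smallness inequality
`16 (ε⁻² + ε⁻¹K¹⁰ + K + 1) ζ² ≤ (C₁/2)(1+ε₀)^{-n₀/2}` (in the assembly: from the `n₀`-smallness of the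
profile). With (a)–(c), the reduced equations of motion (6.129)–(6.133) in the `Context` packaging —
`Context.da_zero`, `db_zero`, `dc_zero`, `dd_zero`, `da_one` — hold with EXACTLY the tree's right-hand
sides (the asymmetry corrections of `SplitCascadeRescaledModes.lean` are absorbed into the other half
of `C₁ (1+ε₀)^{-n₀/2}`), and the whole elementary `Context` API (mode sizes at scales `-2,…,2`,
derivatives, continuity) is the tree's verbatim. Hence the §6.7 files downstream of the setting
(`ZeroScaleCritical`, `…Phase`, `…Tc`, `…CoarseBound`, …) port by renaming. The two raw energy
inequalities `dF_zero`, `dF_negOne` are the exception: their split forms carry the two-way fluxes and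
are given here with the asymmetry part split off and bounded by `C₁(1+ε₀)^{-n₀/2}` (scale `0`) /
kept inside the energy-bounded pump of scale `-2` (scale `-1`). The structures `PrimaryModes`,
`SmallModes`, `ExitTrichotomy`, `NextState`, the derivative abbreviations `dY`, `dF` and the generic
tools are Tao's own (`TaoCascade.ZeroScale.*`), reused.

## References

* T. Tao, J. Amer. Math. Soc. 29 (2016), 601–674 = arXiv:1402.0290v3, §6.5 (6.92)–(6.95),
  Lemma 6.9, §6.6 Prop. 6.13 (6.116)–(6.117), (6.129)–(6.133), §6.7. [`Tao2016AveragedNS`]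
-/

noncomputable section

open Set MeasureTheory intervalIntegral

namespace Literature.Analysis.FluidPDE

namespace Tao2016AveragedNS

open TaoCascade
open TaoCascade.ZeroScale hiding Context

namespace ZeroScale

/-! ## The setting of §6.7 for the split system -/

/-- **The standing hypotheses of §6.7 for the SPLIT system**: the parameter signs, the split Prop. 6.5
hypotheses (i)–(ix)♯ with the corrected `c`-coefficient and HALF the error constant (`C₁/2`), a time
`0 ≤ T ≤ 100` and, on `[0, T]`, the bootstrap bounds (6.92)–(6.95) (`GoodAt`), Lemma 6.9 at scales
`-1, 0` (`PrimaryModes`, for the symmetric amplitudes), the bounds (6.117) of Prop. 6.13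
(`SmallModes`), the asymmetry certificate `|Z̃_{i,k}(t)| ≤ ζ` (`k = -1, 0, 1`) and the master
smallness `16(ε⁻² + ε⁻¹K¹⁰ + K + 1)ζ² ≤ (C₁/2)(1+ε₀)^{-n₀/2}`. [cite: Tao2016AveragedNS, §6.7] -/
structure Context (ε₀ K ε C₁ C₂ C₃ C₄ C₅ : ℝ) (n₀ N : ℤ) (ηp : ℤ → ℝ) (βp : ℕ → ℝ) (τ : ℤ → ℝ)
    (Y : Fin 4 → ℤ → ℝ → ℝ) (W : Fin 3 → ℤ → ℝ → ℝ) (F : ℤ → ℝ → ℝ) (T ζ : ℝ) : Prop where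
  ε₀_pos : 0 < ε₀
  ε₀_lt : ε₀ < 1
  K_ge : 2 ≤ K
  ε_pos : 0 < ε
  ε_le : ε ≤ 1
  C₁_nn : 0 ≤ C₁
  C₂_nn : 0 ≤ C₂
  C₃_nn : 0 ≤ C₃
  C₄_nn : 0 ≤ C₄
  C₅_nn : 0 ≤ C₅
  le_N : n₀ ≤ N
  /-- The split Prop. 6.5 hypotheses with error constant `C₁/2`. -/
  hyp : RescaledSplitHypotheses (1 / 10 ^ 5 * Real.exp (-K ^ 10 / 2)) ε₀ K ε (C₁ / 2) C₂ C₃ n₀ N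
    ηp βp τ Y W F
  T_nn : 0 ≤ T
  T_le : T ≤ 100
  /-- The bootstrap bounds (6.92)–(6.95) of §6.5 (`GoodAt`) on `[0, T]`. -/
  loc : ∀ t ∈ Icc 0 T, GoodAt ε₀ K Y F t
  prim : PrimaryModes ε₀ C₅ n₀ Y F T
  small : SmallModes K ε C₄ Y T
  /-- The asymmetry certificate on the window, scales `-1, 0, 1`. -/
  asym : ∀ t ∈ Icc 0 T, ∀ i : Fin 3, |W i (-1) t| ≤ ζ ∧ |W i 0 t| ≤ ζ ∧ |W i 1 t| ≤ ζ
  /-- The master smallness of the asymmetry (absorbs every asymmetry correction of the reduced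
  equations into `(C₁/2)(1+ε₀)^{-n₀/2}`). -/
  asym_small : 16 * ((ε ^ 2)⁻¹ + ε⁻¹ * K ^ 10 + K + 1) * ζ ^ 2 ≤ C₁ / 2 * (1 + ε₀) ^ (-(n₀ : ℝ) / 2)

section Basic

variable {ε₀ K ε C₁ C₂ C₃ C₄ C₅ : ℝ} {n₀ N : ℤ} {ηp : ℤ → ℝ} {βp : ℕ → ℝ} {τ : ℤ → ℝ}
  {Y : Fin 4 → ℤ → ℝ → ℝ} {W : Fin 3 → ℤ → ℝ → ℝ} {F : ℤ → ℝ → ℝ} {T ζ : ℝ}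

/-- Half the error constant is non-negative. (parameter bookkeeping of the hierarchy
`1 ≪ 1/ε₀ ≪ K ≪ 1/ε ≪ n₀` of §6.1). [cite: Tao2016AveragedNS, §6.1] -/
theorem Context.C₁_half_nn (cx : Context ε₀ K ε C₁ C₂ C₃ C₄ C₅ n₀ N ηp βp τ Y W F T ζ) :
    0 ≤ C₁ / 2 := by linarith [cx.C₁_nn]

/-- The asymmetry certificate: `0 ≤ ζ` (when `T ≥ 0` the window is non-empty). [cite: Tao2016AveragedNS, §6.7] -/
theorem Context.ζ_nn (cx : Context ε₀ K ε C₁ C₂ C₃ C₄ C₅ n₀ N ηp βp τ Y W F T ζ) : 0 ≤ ζ :=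
  (abs_nonneg _).trans ((cx.asym 0 ⟨le_rfl, cx.T_nn⟩ 0).1)

/-- Asymmetry bound at scale `-1` on `[0, T]`. [cite: Tao2016AveragedNS, §6.7] -/
theorem Context.absW_negOne_le (cx : Context ε₀ K ε C₁ C₂ C₃ C₄ C₅ n₀ N ηp βp τ Y W F T ζ)
    (i : Fin 3) {t : ℝ} (ht : t ∈ Icc 0 T) : |W i (-1) t| ≤ ζ := (cx.asym t ht i).1

/-- Asymmetry bound at scale `0` on `[0, T]`. [cite: Tao2016AveragedNS, §6.7] -/
theorem Context.absW_zero_le (cx : Context ε₀ K ε C₁ C₂ C₃ C₄ C₅ n₀ N ηp βp τ Y W F T ζ)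
    (i : Fin 3) {t : ℝ} (ht : t ∈ Icc 0 T) : |W i 0 t| ≤ ζ := (cx.asym t ht i).2.1

/-- Asymmetry bound at scale `1` on `[0, T]`. [cite: Tao2016AveragedNS, §6.7] -/
theorem Context.absW_one_le (cx : Context ε₀ K ε C₁ C₂ C₃ C₄ C₅ n₀ N ηp βp τ Y W F T ζ)
    (i : Fin 3) {t : ℝ} (ht : t ∈ Icc 0 T) : |W i 1 t| ≤ ζ := (cx.asym t ht i).2.2

/-- The individual asymmetry budgets out of the master smallness:
`ε⁻²ζ², (ε + ε⁻¹K¹⁰)ζ², ζ², 8(ε⁻² + K)ζ², 14Kζ² ≤ (C₁/2)(1+ε₀)^{-n₀/2}`. [cite: Tao2016AveragedNS, §6.7] -/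
theorem Context.asym_budget (cx : Context ε₀ K ε C₁ C₂ C₃ C₄ C₅ n₀ N ηp βp τ Y W F T ζ) :
    (ε ^ 2)⁻¹ * ζ ^ 2 ≤ C₁ / 2 * (1 + ε₀) ^ (-(n₀ : ℝ) / 2) ∧
    (ε + ε⁻¹ * K ^ 10) * ζ ^ 2 ≤ C₁ / 2 * (1 + ε₀) ^ (-(n₀ : ℝ) / 2) ∧
    ζ ^ 2 ≤ C₁ / 2 * (1 + ε₀) ^ (-(n₀ : ℝ) / 2) ∧
    8 * ((ε ^ 2)⁻¹ + K) * ζ ^ 2 ≤ C₁ / 2 * (1 + ε₀) ^ (-(n₀ : ℝ) / 2) ∧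
    14 * K * ζ ^ 2 ≤ C₁ / 2 * (1 + ε₀) ^ (-(n₀ : ℝ) / 2) := by
  have hm := cx.asym_small
  have hε := cx.ε_pos
  have hε1 := cx.ε_le
  have hK : 0 < K := by linarith [cx.K_ge]
  have hz : 0 ≤ ζ ^ 2 := sq_nonneg _
  have h1 : 0 ≤ (ε ^ 2)⁻¹ * ζ ^ 2 := by positivity
  have h2 : 0 ≤ ε⁻¹ * K ^ 10 * ζ ^ 2 := by positivity
  have h3 : 0 ≤ K * ζ ^ 2 := by positivity
  have h4 : ε * ζ ^ 2 ≤ ζ ^ 2 := by nlinarith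
  refine ⟨by nlinarith, by nlinarith, by nlinarith, by nlinarith, by nlinarith⟩

/-! ## Derivatives of the modes -/

/-- The initial rescaled time is `≤ 0`. [cite: Tao2016AveragedNS, §6.7] -/
theorem Context.τ₀_le (cx : Context ε₀ K ε C₁ C₂ C₃ C₄ C₅ n₀ N ηp βp τ Y W F T ζ) : τ (n₀ - N) ≤ 0 :=
  cx.hyp.tau_le _ le_rfl (by linarith [cx.le_N])

/-- `0 < 1 + ε₀`. (parameter bookkeeping of the hierarchy
`1 ≪ 1/ε₀ ≪ K ≪ 1/ε ≪ n₀` of §6.1). [cite: Tao2016AveragedNS, §6.1] -/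
theorem Context.q_pos (cx : Context ε₀ K ε C₁ C₂ C₃ C₄ C₅ n₀ N ηp βp τ Y W F T ζ) : 0 < 1 + ε₀ := by
  linarith [cx.ε₀_pos]

/-- `1 < 1 + ε₀`. (parameter bookkeeping of the hierarchy
`1 ≪ 1/ε₀ ≪ K ≪ 1/ε ≪ n₀` of §6.1). [cite: Tao2016AveragedNS, §6.1] -/
theorem Context.one_lt_q (cx : Context ε₀ K ε C₁ C₂ C₃ C₄ C₅ n₀ N ηp βp τ Y W F T ζ) : 1 < 1 + ε₀ := by
  linarith [cx.ε₀_pos]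

/-- `1 + ε₀ < 2`. (parameter bookkeeping of the hierarchy
`1 ≪ 1/ε₀ ≪ K ≪ 1/ε ≪ n₀` of §6.1). [cite: Tao2016AveragedNS, §6.1] -/
theorem Context.q_lt_two (cx : Context ε₀ K ε C₁ C₂ C₃ C₄ C₅ n₀ N ηp βp τ Y W F T ζ) : 1 + ε₀ < 2 := by
  linarith [cx.ε₀_lt]

/-- `0 < K`. (parameter bookkeeping of the hierarchy
`1 ≪ 1/ε₀ ≪ K ≪ 1/ε ≪ n₀` of §6.1). [cite: Tao2016AveragedNS, §6.1] -/
theorem Context.K_pos (cx : Context ε₀ K ε C₁ C₂ C₃ C₄ C₅ n₀ N ηp βp τ Y W F T ζ) : 0 < K := by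
  linarith [cx.K_ge]

/-- `1 ≤ K`. (parameter bookkeeping of the hierarchy
`1 ≪ 1/ε₀ ≪ K ≪ 1/ε ≪ n₀` of §6.1). [cite: Tao2016AveragedNS, §6.1] -/
theorem Context.one_le_K (cx : Context ε₀ K ε C₁ C₂ C₃ C₄ C₅ n₀ N ηp βp τ Y W F T ζ) : 1 ≤ K := by
  linarith [cx.K_ge]

/-- `K⁻ⁿ ≤ 1/2` for `n ≥ 1`. (parameter bookkeeping of the hierarchy
`1 ≪ 1/ε₀ ≪ K ≪ 1/ε ≪ n₀` of §6.1). [cite: Tao2016AveragedNS, §6.1] -/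
theorem Context.inv_K_pow_le_half (cx : Context ε₀ K ε C₁ C₂ C₃ C₄ C₅ n₀ N ηp βp τ Y W F T ζ) {n : ℕ}
    (hn : 1 ≤ n) : (K ^ n)⁻¹ ≤ 1 / 2 := by
  have h2 : (2 : ℝ) ≤ K ^ n := by
    calc (2 : ℝ) = 2 ^ 1 := by norm_num
      _ ≤ 2 ^ n := pow_le_pow_right₀ (by norm_num) hn
      _ ≤ K ^ n := pow_le_pow_left₀ (by norm_num) cx.K_ge n
  rw [one_div]
  exact inv_anti₀ (by norm_num) h2

/-- `(1+ε₀)^x ≤ 2^x` for `x ≥ 0`. (parameter bookkeeping of the hierarchy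
`1 ≪ 1/ε₀ ≪ K ≪ 1/ε ≪ n₀` of §6.1). [cite: Tao2016AveragedNS, §6.1] -/
theorem Context.q_rpow_le (cx : Context ε₀ K ε C₁ C₂ C₃ C₄ C₅ n₀ N ηp βp τ Y W F T ζ) {x : ℝ}
    (hx : 0 ≤ x) : (1 + ε₀) ^ x ≤ (2 : ℝ) ^ x :=
  Real.rpow_le_rpow cx.q_pos.le cx.q_lt_two.le hx

/-- `(1+ε₀)^x ≤ 1` for `x ≤ 0`. (parameter bookkeeping of the hierarchy
`1 ≪ 1/ε₀ ≪ K ≪ 1/ε ≪ n₀` of §6.1). [cite: Tao2016AveragedNS, §6.1] -/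
theorem Context.q_rpow_le_one (cx : Context ε₀ K ε C₁ C₂ C₃ C₄ C₅ n₀ N ηp βp τ Y W F T ζ) {x : ℝ}
    (hx : x ≤ 0) : (1 + ε₀) ^ x ≤ 1 :=
  Real.rpow_le_one_of_one_le_of_nonpos cx.one_lt_q.le hx

/-- `1 ≤ (1+ε₀)^x` for `0 ≤ x`. (parameter bookkeeping of the hierarchy
`1 ≪ 1/ε₀ ≪ K ≪ 1/ε ≪ n₀` of §6.1). [cite: Tao2016AveragedNS, §6.1] -/
theorem Context.one_le_q_rpow (cx : Context ε₀ K ε C₁ C₂ C₃ C₄ C₅ n₀ N ηp βp τ Y W F T ζ) {x : ℝ}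
    (hx : 0 ≤ x) : 1 ≤ (1 + ε₀) ^ x :=
  Real.one_le_rpow cx.one_lt_q.le hx

/-- Right derivative of a mode at `t ≥ τ₀`. [cite: Tao2016AveragedNS, §6.7] -/
theorem Context.hasDerivWithinAt_Y (cx : Context ε₀ K ε C₁ C₂ C₃ C₄ C₅ n₀ N ηp βp τ Y W F T ζ) (i : Fin 4)
    (k : ℤ) {t : ℝ} (ht : τ (n₀ - N) ≤ t) :
    HasDerivWithinAt (Y i k) (dY (τ (n₀ - N)) Y i k t) (Ici t) t :=
  cx.hyp.hasDeriv_X i k ht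

/-- Right derivative of an energy at `t ≥ τ₀`. [cite: Tao2016AveragedNS, §6.7] -/
theorem Context.hasDerivWithinAt_F (cx : Context ε₀ K ε C₁ C₂ C₃ C₄ C₅ n₀ N ηp βp τ Y W F T ζ) (k : ℤ)
    {t : ℝ} (ht : τ (n₀ - N) ≤ t) :
    HasDerivWithinAt (F k) (dF (τ (n₀ - N)) F k t) (Ici t) t :=
  cx.hyp.hasDeriv_E k ht

/-- The modes are continuous on every `[a, b]` with `τ₀ ≤ a`. [cite: Tao2016AveragedNS, §6.7] -/
theorem Context.continuousOn_Y (cx : Context ε₀ K ε C₁ C₂ C₃ C₄ C₅ n₀ N ηp βp τ Y W F T ζ) (i : Fin 4)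
    (k : ℤ) {a b : ℝ} (ha : τ (n₀ - N) ≤ a) : ContinuousOn (Y i k) (Icc a b) :=
  cx.hyp.continuousOn_X i k ha

/-- The energies are continuous on every `[a, b]` with `τ₀ ≤ a`. [cite: Tao2016AveragedNS, §6.7] -/
theorem Context.continuousOn_F (cx : Context ε₀ K ε C₁ C₂ C₃ C₄ C₅ n₀ N ηp βp τ Y W F T ζ) (k : ℤ)
    {a b : ℝ} (ha : τ (n₀ - N) ≤ a) : ContinuousOn (F k) (Icc a b) :=
  cx.hyp.continuousOn_E k ha

/-- The mode derivatives are continuous on every `[a, b]` with `τ₀ ≤ a`. [cite: Tao2016AveragedNS, §6.7] -/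
theorem Context.continuousOn_dY (cx : Context ε₀ K ε C₁ C₂ C₃ C₄ C₅ n₀ N ηp βp τ Y W F T ζ) (i : Fin 4)
    (k : ℤ) {a b : ℝ} (ha : τ (n₀ - N) ≤ a) : ContinuousOn (dY (τ (n₀ - N)) Y i k) (Icc a b) :=
  ODE.continuousOn_derivWithin_Icc_of_contDiffOn (cx.hyp.contDiffOn_Y i k) ha

/-- The energy derivatives are continuous on every `[a, b]` with `τ₀ ≤ a`. [cite: Tao2016AveragedNS, §6.7] -/
theorem Context.continuousOn_dF (cx : Context ε₀ K ε C₁ C₂ C₃ C₄ C₅ n₀ N ηp βp τ Y W F T ζ) (k : ℤ)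
    {a b : ℝ} (ha : τ (n₀ - N) ≤ a) : ContinuousOn (dF (τ (n₀ - N)) F k) (Icc a b) :=
  ODE.continuousOn_derivWithin_Icc_of_contDiffOn (cx.hyp.contDiffOn_F k) ha

/-! ## Mode bounds from the energy bounds -/

/-- `|Y_{i,k}(t)| ≤ √(2 Ẽ_k(t))` (landed `RescaledSplitHypotheses.abs_le_sqrt_energy`).
[cite: Tao2016AveragedNS, §6.4 Prop. 6.5 (iv)] -/
theorem Context.abs_Y_le_sqrt (cx : Context ε₀ K ε C₁ C₂ C₃ C₄ C₅ n₀ N ηp βp τ Y W F T ζ) (i : Fin 4)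
    (k : ℤ) {t : ℝ} (ht : τ (n₀ - N) ≤ t) : |Y i k t| ≤ Real.sqrt (2 * F k t) :=
  cx.hyp.abs_le_sqrt_energy i k ht

/-- `Y_{i,k}(t)² ≤ 2 Ẽ_k(t)` (landed `RescaledSplitHypotheses.sq_le_two_mul_energy`).
[cite: Tao2016AveragedNS, §6.4 Prop. 6.5 (iv)] -/
theorem Context.sq_Y_le (cx : Context ε₀ K ε C₁ C₂ C₃ C₄ C₅ n₀ N ηp βp τ Y W F T ζ) (i : Fin 4)
    (k : ℤ) {t : ℝ} (ht : τ (n₀ - N) ≤ t) : Y i k t ^ 2 ≤ 2 * F k t :=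
  cx.hyp.sq_le_two_mul_energy i k ht

/-- On `[0, T]`: `Ẽ₀ ≤ 1`, `Ẽ₁ ≤ 1`. [cite: Tao2016AveragedNS, §6.7] -/
theorem Context.F_zero_le_one (cx : Context ε₀ K ε C₁ C₂ C₃ C₄ C₅ n₀ N ηp βp τ Y W F T ζ) {t : ℝ}
    (ht : t ∈ Icc 0 T) : F 0 t ≤ 1 := by
  have h := (cx.loc t ht).during
  have h1 := cx.hyp.nonneg_F 1 t (cx.τ₀_le.trans ht.1)
  linarith

/-- On `[0, T]`: `Ẽ₁ ≤ 1`. [cite: Tao2016AveragedNS, §6.7] -/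
theorem Context.F_one_le_one (cx : Context ε₀ K ε C₁ C₂ C₃ C₄ C₅ n₀ N ηp βp τ Y W F T ζ) {t : ℝ}
    (ht : t ∈ Icc 0 T) : F 1 t ≤ 1 := by
  have h := (cx.loc t ht).during
  have h1 := cx.hyp.nonneg_F 0 t (cx.τ₀_le.trans ht.1)
  linarith

/-- On `[0, T]`: `Ẽ_{-1} ≤ 2 K⁻¹⁰`. [cite: Tao2016AveragedNS, §6.7] -/
theorem Context.F_negOne_le (cx : Context ε₀ K ε C₁ C₂ C₃ C₄ C₅ n₀ N ηp βp τ Y W F T ζ) {t : ℝ}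
    (ht : t ∈ Icc 0 T) : F (-1) t ≤ 2 * (K ^ 10)⁻¹ := by
  have h := (cx.loc t ht).before 2 le_rfl
  have h2 : (1 + ε₀) ^ (((2 : ℕ) : ℝ) / 10) ≤ 2 := by
    calc (1 + ε₀) ^ (((2 : ℕ) : ℝ) / 10) ≤ (2 : ℝ) ^ (((2 : ℕ) : ℝ) / 10) :=
          cx.q_rpow_le (by norm_num)
      _ ≤ (2 : ℝ) ^ (1 : ℝ) := Real.rpow_le_rpow_of_exponent_le (by norm_num) (by norm_num)
      _ = 2 := Real.rpow_one 2
  have hK : 0 ≤ (K ^ 10)⁻¹ := by have := cx.K_pos; positivity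
  have : (1 : ℤ) - ((2 : ℕ) : ℤ) = -1 := by norm_num
  rw [this] at h
  calc F (-1) t ≤ (K ^ 10)⁻¹ * (1 + ε₀) ^ (((2 : ℕ) : ℝ) / 10) := h
    _ ≤ (K ^ 10)⁻¹ * 2 := by gcongr
    _ = 2 * (K ^ 10)⁻¹ := by ring

/-- On `[0, T]`: `Ẽ_{-2} ≤ 2 K⁻¹⁰`. [cite: Tao2016AveragedNS, §6.7] -/
theorem Context.F_negTwo_le (cx : Context ε₀ K ε C₁ C₂ C₃ C₄ C₅ n₀ N ηp βp τ Y W F T ζ) {t : ℝ}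
    (ht : t ∈ Icc 0 T) : F (-2) t ≤ 2 * (K ^ 10)⁻¹ := by
  have h := (cx.loc t ht).before 3 (by norm_num)
  have h2 : (1 + ε₀) ^ (((3 : ℕ) : ℝ) / 10) ≤ 2 := by
    calc (1 + ε₀) ^ (((3 : ℕ) : ℝ) / 10) ≤ (2 : ℝ) ^ (((3 : ℕ) : ℝ) / 10) :=
          cx.q_rpow_le (by norm_num)
      _ ≤ (2 : ℝ) ^ (1 : ℝ) := Real.rpow_le_rpow_of_exponent_le (by norm_num) (by norm_num)
      _ = 2 := Real.rpow_one 2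
  have hK : 0 ≤ (K ^ 10)⁻¹ := by have := cx.K_pos; positivity
  have : (1 : ℤ) - ((3 : ℕ) : ℤ) = -2 := by norm_num
  rw [this] at h
  calc F (-2) t ≤ (K ^ 10)⁻¹ * (1 + ε₀) ^ (((3 : ℕ) : ℝ) / 10) := h
    _ ≤ (K ^ 10)⁻¹ * 2 := by gcongr
    _ = 2 * (K ^ 10)⁻¹ := by ring

/-- On `[0, T]`: `Ẽ₂ ≤ K⁻³⁰`. [cite: Tao2016AveragedNS, §6.7] -/
theorem Context.F_two_le (cx : Context ε₀ K ε C₁ C₂ C₃ C₄ C₅ n₀ N ηp βp τ Y W F T ζ) {t : ℝ}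
    (ht : t ∈ Icc 0 T) : F 2 t ≤ (K ^ 30)⁻¹ := by
  have h := (cx.loc t ht).after 1 le_rfl
  have h2 : (1 + ε₀) ^ (-(10 : ℝ) * ((1 : ℕ) : ℝ)) ≤ 1 := cx.q_rpow_le_one (by norm_num)
  have hK : 0 ≤ (K ^ 30)⁻¹ := by have := cx.K_pos; positivity
  have : (1 : ℤ) + ((1 : ℕ) : ℤ) = 2 := by norm_num
  rw [this] at h
  calc F 2 t ≤ (K ^ 30)⁻¹ * (1 + ε₀) ^ (-(10 : ℝ) * ((1 : ℕ) : ℝ)) := h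
    _ ≤ (K ^ 30)⁻¹ * 1 := by gcongr
    _ = (K ^ 30)⁻¹ := by ring

/-- On `[0, T]`: the scale-`0` and scale-`1` modes are bounded by `√2 ≤ 3/2`. [cite: Tao2016AveragedNS, §6.7] -/
theorem Context.abs_Y_zero_le (cx : Context ε₀ K ε C₁ C₂ C₃ C₄ C₅ n₀ N ηp βp τ Y W F T ζ) (i : Fin 4)
    {t : ℝ} (ht : t ∈ Icc 0 T) : |Y i 0 t| ≤ 3 / 2 := by
  have h := cx.sq_Y_le i 0 (cx.τ₀_le.trans ht.1)
  have hF := cx.F_zero_le_one ht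
  rw [abs_le]; constructor <;> nlinarith

/-- On `[0, T]`: `|Y_{i,1}| ≤ 3/2`. [cite: Tao2016AveragedNS, §6.7] -/
theorem Context.abs_Y_one_le (cx : Context ε₀ K ε C₁ C₂ C₃ C₄ C₅ n₀ N ηp βp τ Y W F T ζ) (i : Fin 4)
    {t : ℝ} (ht : t ∈ Icc 0 T) : |Y i 1 t| ≤ 3 / 2 := by
  have h := cx.sq_Y_le i 1 (cx.τ₀_le.trans ht.1)
  have hF := cx.F_one_le_one ht
  rw [abs_le]; constructor <;> nlinarith

/-- On `[0, T]`: `Y_{i,0}² ≤ 2`, `Y_{i,1}² ≤ 2`. [cite: Tao2016AveragedNS, §6.7] -/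
theorem Context.sq_Y_zero_le (cx : Context ε₀ K ε C₁ C₂ C₃ C₄ C₅ n₀ N ηp βp τ Y W F T ζ) (i : Fin 4)
    {t : ℝ} (ht : t ∈ Icc 0 T) : Y i 0 t ^ 2 ≤ 2 := by
  have h := cx.sq_Y_le i 0 (cx.τ₀_le.trans ht.1)
  have hF := cx.F_zero_le_one ht
  linarith

/-- On `[0, T]`: `Y_{i,1}² ≤ 2`. [cite: Tao2016AveragedNS, §6.7] -/
theorem Context.sq_Y_one_le (cx : Context ε₀ K ε C₁ C₂ C₃ C₄ C₅ n₀ N ηp βp τ Y W F T ζ) (i : Fin 4)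
    {t : ℝ} (ht : t ∈ Icc 0 T) : Y i 1 t ^ 2 ≤ 2 := by
  have h := cx.sq_Y_le i 1 (cx.τ₀_le.trans ht.1)
  have hF := cx.F_one_le_one ht
  linarith

/-- On `[0, T]`: `Y_{i,-1}² ≤ 4 K⁻¹⁰` and `Y_{i,-2}² ≤ 4 K⁻¹⁰`. [cite: Tao2016AveragedNS, §6.7] -/
theorem Context.sq_Y_negOne_le (cx : Context ε₀ K ε C₁ C₂ C₃ C₄ C₅ n₀ N ηp βp τ Y W F T ζ) (i : Fin 4)
    {t : ℝ} (ht : t ∈ Icc 0 T) : Y i (-1) t ^ 2 ≤ 4 * (K ^ 10)⁻¹ := by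
  have h := cx.sq_Y_le i (-1) (cx.τ₀_le.trans ht.1)
  have hF := cx.F_negOne_le ht
  linarith

/-- On `[0, T]`: `Y_{i,-2}² ≤ 4 K⁻¹⁰`. [cite: Tao2016AveragedNS, §6.7] -/
theorem Context.sq_Y_negTwo_le (cx : Context ε₀ K ε C₁ C₂ C₃ C₄ C₅ n₀ N ηp βp τ Y W F T ζ) (i : Fin 4)
    {t : ℝ} (ht : t ∈ Icc 0 T) : Y i (-2) t ^ 2 ≤ 4 * (K ^ 10)⁻¹ := by
  have h := cx.sq_Y_le i (-2) (cx.τ₀_le.trans ht.1)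
  have hF := cx.F_negTwo_le ht
  linarith

/-- On `[0, T]`: `|Y_{i,-1}| ≤ 2 K⁻⁵`, `|Y_{i,-2}| ≤ 2 K⁻⁵`, `|Y_{i,2}| ≤ 2 K⁻¹⁵`. [cite: Tao2016AveragedNS, §6.7] -/
theorem Context.abs_Y_negOne_le (cx : Context ε₀ K ε C₁ C₂ C₃ C₄ C₅ n₀ N ηp βp τ Y W F T ζ) (i : Fin 4)
    {t : ℝ} (ht : t ∈ Icc 0 T) : |Y i (-1) t| ≤ 2 * (K ^ 5)⁻¹ := by
  have h := cx.sq_Y_negOne_le i ht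
  have hK := cx.K_pos
  have hK5 : 0 < (K ^ 5)⁻¹ := by positivity
  have : (K ^ 10)⁻¹ = (K ^ 5)⁻¹ ^ 2 := by rw [← inv_pow]; ring
  rw [this] at h
  rw [abs_le]; constructor <;> nlinarith

/-- On `[0, T]`: `|Y_{i,-2}| ≤ 2 K⁻⁵`. [cite: Tao2016AveragedNS, §6.7] -/
theorem Context.abs_Y_negTwo_le (cx : Context ε₀ K ε C₁ C₂ C₃ C₄ C₅ n₀ N ηp βp τ Y W F T ζ) (i : Fin 4)
    {t : ℝ} (ht : t ∈ Icc 0 T) : |Y i (-2) t| ≤ 2 * (K ^ 5)⁻¹ := by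
  have h := cx.sq_Y_negTwo_le i ht
  have hK := cx.K_pos
  have hK5 : 0 < (K ^ 5)⁻¹ := by positivity
  have : (K ^ 10)⁻¹ = (K ^ 5)⁻¹ ^ 2 := by rw [← inv_pow]; ring
  rw [this] at h
  rw [abs_le]; constructor <;> nlinarith

/-- On `[0, T]`: `|Y_{i,2}| ≤ 2 K⁻¹⁵`. [cite: Tao2016AveragedNS, §6.7] -/
theorem Context.abs_Y_two_le (cx : Context ε₀ K ε C₁ C₂ C₃ C₄ C₅ n₀ N ηp βp τ Y W F T ζ) (i : Fin 4)
    {t : ℝ} (ht : t ∈ Icc 0 T) : |Y i 2 t| ≤ 2 * (K ^ 15)⁻¹ := by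
  have h := cx.sq_Y_le i 2 (cx.τ₀_le.trans ht.1)
  have hF := cx.F_two_le ht
  have hK := cx.K_pos
  have hK5 : 0 < (K ^ 15)⁻¹ := by positivity
  have : (K ^ 30)⁻¹ = (K ^ 15)⁻¹ ^ 2 := by rw [← inv_pow]; ring
  rw [this] at hF
  rw [abs_le]; constructor <;> nlinarith

/-- `√(Ẽ₀) ≤ 1` and `√(Ẽ₁) ≤ 1` on `[0, T]`. [cite: Tao2016AveragedNS, §6.7] -/
theorem Context.sqrt_F_zero_le (cx : Context ε₀ K ε C₁ C₂ C₃ C₄ C₅ n₀ N ηp βp τ Y W F T ζ) {t : ℝ}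
    (ht : t ∈ Icc 0 T) : Real.sqrt (F 0 t) ≤ 1 := by
  rw [show (1 : ℝ) = Real.sqrt 1 by simp]
  exact Real.sqrt_le_sqrt (cx.F_zero_le_one ht)

/-- On `[0, T]`: `√Ẽ₁ ≤ 1`. [cite: Tao2016AveragedNS, §6.7] -/
theorem Context.sqrt_F_one_le (cx : Context ε₀ K ε C₁ C₂ C₃ C₄ C₅ n₀ N ηp βp τ Y W F T ζ) {t : ℝ}
    (ht : t ∈ Icc 0 T) : Real.sqrt (F 1 t) ≤ 1 := by
  rw [show (1 : ℝ) = Real.sqrt 1 by simp]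
  exact Real.sqrt_le_sqrt (cx.F_one_le_one ht)

/-- On `[0, T]`: `√Ẽ₋₁ ≤ 1`. [cite: Tao2016AveragedNS, §6.7] -/
theorem Context.sqrt_F_negOne_le (cx : Context ε₀ K ε C₁ C₂ C₃ C₄ C₅ n₀ N ηp βp τ Y W F T ζ) {t : ℝ}
    (ht : t ∈ Icc 0 T) : Real.sqrt (F (-1) t) ≤ 1 := by
  rw [show (1 : ℝ) = Real.sqrt 1 by simp]
  apply Real.sqrt_le_sqrt
  have := cx.F_negOne_le ht
  have hK : (K ^ 10)⁻¹ ≤ 1 / 2 := cx.inv_K_pow_le_half (by norm_num)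
  linarith

/-! ## The reduced equations of motion (6.129)–(6.133) on `[0, T]` -/

/-- The viscosity error size `C₁ (1+ε₀)^{-n₀/2}` at scale `0`. [cite: Tao2016AveragedNS, §6.7] -/
theorem Context.err_zero (cx : Context ε₀ K ε C₁ C₂ C₃ C₄ C₅ n₀ N ηp βp τ Y W F T ζ) {t : ℝ}
    (ht : t ∈ Icc 0 T) :
    C₁ * (1 + ε₀) ^ ((2 : ℝ) * ((0 : ℤ) : ℝ) - n₀ / 2) * Real.sqrt (F 0 t) ≤
      C₁ * (1 + ε₀) ^ (-(n₀ : ℝ) / 2) := by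
  have h1 : (1 + ε₀) ^ ((2 : ℝ) * ((0 : ℤ) : ℝ) - n₀ / 2) = (1 + ε₀) ^ (-(n₀ : ℝ) / 2) := by
    congr 1; push_cast; ring
  rw [h1]
  have := cx.sqrt_F_zero_le ht
  have h0 : 0 ≤ C₁ * (1 + ε₀) ^ (-(n₀ : ℝ) / 2) := mul_nonneg cx.C₁_nn (Real.rpow_nonneg cx.q_pos.le _)
  calc C₁ * (1 + ε₀) ^ (-(n₀ : ℝ) / 2) * Real.sqrt (F 0 t) ≤ C₁ * (1 + ε₀) ^ (-(n₀ : ℝ) / 2) * 1 := by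
        gcongr
    _ = _ := mul_one _

/-- **(6.129)**: `|∂ₜa₀ + ε⁻² c₀ d₀| ≤ 5ε + 2K Ẽ_{-1} + C₁ (1+ε₀)^{-n₀/2}` on `[0, T]` (the printed
`O(K⁻⁹)`, with `Ẽ_{-1}` kept explicit for the later improvement (6.179)).
[cite: Tao2016AveragedNS, §6.6 (6.129)] -/
theorem Context.da_zero (cx : Context ε₀ K ε C₁ C₂ C₃ C₄ C₅ n₀ N ηp βp τ Y W F T ζ) {t : ℝ}
    (ht : t ∈ Icc 0 T) :
    |dY (τ (n₀ - N)) Y 0 0 t + (ε ^ 2)⁻¹ * Y 2 0 t * Y 3 0 t| ≤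
      5 * ε + 2 * K * F (-1) t + C₁ * (1 + ε₀) ^ (-(n₀ : ℝ) / 2) := by
  have h := cx.hyp.eq_a_zero cx.ε_pos.le cx.K_pos.le cx.C₁_half_nn (by linarith [cx.ε₀_pos])
    (cx.τ₀_le.trans ht.1) (cx.F_zero_le_one ht) le_rfl (cx.absW_zero_le 1 ht) (cx.absW_zero_le 2 ht)
  rw [rpow_neg_half_eq] at h
  have hε := cx.ε_pos
  have hε1 := cx.ε_le
  have hexp : Real.exp (-K ^ 10) ≤ 1 := by
    rw [Real.exp_le_one_iff]; have := pow_nonneg cx.K_pos.le 10; linarith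
  have : 2 * ε ^ 2 * Real.exp (-K ^ 10) ≤ 3 * ε := by nlinarith [Real.exp_pos (-K ^ 10)]
  have hb := cx.asym_budget.1
  exact h.trans (by linarith)

/-- **(6.130)**: `|∂ₜb₀ - (ε a₀² - ε⁻¹ K¹⁰ c₀²)| ≤ C₁ (1+ε₀)^{-n₀/2}` on `[0, T]`.
[cite: Tao2016AveragedNS, §6.6 (6.130)] -/
theorem Context.db_zero (cx : Context ε₀ K ε C₁ C₂ C₃ C₄ C₅ n₀ N ηp βp τ Y W F T ζ) {t : ℝ}
    (ht : t ∈ Icc 0 T) :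
    |dY (τ (n₀ - N)) Y 1 0 t - (ε * Y 0 0 t ^ 2 - ε⁻¹ * K ^ 10 * Y 2 0 t ^ 2)| ≤
      C₁ * (1 + ε₀) ^ (-(n₀ : ℝ) / 2) := by
  have h := cx.hyp.eq_b_zero cx.ε_pos.le cx.C₁_half_nn (by linarith [cx.ε₀_pos])
    (cx.τ₀_le.trans ht.1) (cx.F_zero_le_one ht) (cx.absW_zero_le 0 ht) (cx.absW_zero_le 1 ht)
  rw [rpow_neg_half_eq] at h
  have hb := cx.asym_budget.2.1
  exact h.trans (by linarith)

/-- **(6.131)**: `|∂ₜc₀ - (ε² e^{-K¹⁰} a₀² + ε⁻¹ K¹⁰ b₀ c₀)| ≤ C₁ (1+ε₀)^{-n₀/2}` on `[0, T]`.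
[cite: Tao2016AveragedNS, §6.6 (6.131)] -/
theorem Context.dc_zero (cx : Context ε₀ K ε C₁ C₂ C₃ C₄ C₅ n₀ N ηp βp τ Y W F T ζ) {t : ℝ}
    (ht : t ∈ Icc 0 T) :
    |dY (τ (n₀ - N)) Y 2 0 t -
        (ε ^ 2 * Real.exp (-K ^ 10) * Y 0 0 t ^ 2 + ε⁻¹ * K ^ 10 * Y 1 0 t * Y 2 0 t)| ≤
      C₁ * (1 + ε₀) ^ (-(n₀ : ℝ) / 2) := by
  have h := cx.hyp.eq_c_zero cx.C₁_half_nn (by linarith [cx.ε₀_pos]) (cx.τ₀_le.trans ht.1)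
    (cx.F_zero_le_one ht) (cx.absW_zero_le 0 ht)
  rw [rpow_neg_half_eq] at h
  have hb := cx.asym_budget.2.2.1
  have hε := cx.ε_pos
  have hε1 := cx.ε_le
  have hexp : Real.exp (-K ^ 10) ≤ 1 := by
    rw [Real.exp_le_one_iff]; have := pow_nonneg cx.K_pos.le 10; linarith
  have hz : 0 ≤ ζ ^ 2 := sq_nonneg _
  have : ε ^ 2 * Real.exp (-K ^ 10) * ζ ^ 2 ≤ ζ ^ 2 := by
    have h1 : ε ^ 2 * Real.exp (-K ^ 10) ≤ 1 := by
      calc ε ^ 2 * Real.exp (-K ^ 10) ≤ 1 ^ 2 * 1 := by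
            gcongr
        _ = 1 := by ring
    nlinarith
  exact h.trans (by linarith)

/-- **(6.132)**: `|∂ₜd₀ - (ε⁻² c₀ a₀ - (1+ε₀)^{5/2} K d₀ a₁)| ≤ C₁ (1+ε₀)^{-n₀/2}` on `[0, T]`.
[cite: Tao2016AveragedNS, §6.6 (6.132)] -/
theorem Context.dd_zero (cx : Context ε₀ K ε C₁ C₂ C₃ C₄ C₅ n₀ N ηp βp τ Y W F T ζ) {t : ℝ}
    (ht : t ∈ Icc 0 T) :
    |dY (τ (n₀ - N)) Y 3 0 t -
        ((ε ^ 2)⁻¹ * Y 2 0 t * Y 0 0 t - (1 + ε₀) ^ ((5 : ℝ) / 2) * K * Y 3 0 t * Y 0 1 t)| ≤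
      C₁ * (1 + ε₀) ^ (-(n₀ : ℝ) / 2) := by
  have h := cx.hyp.eq_d_zero cx.C₁_half_nn (by linarith [cx.ε₀_pos]) (cx.τ₀_le.trans ht.1)
    (cx.F_zero_le_one ht) (cx.absW_zero_le 0 ht) (cx.absW_zero_le 1 ht)
  rw [rpow_neg_half_eq] at h
  have hb := cx.asym_budget.1
  exact h.trans (by linarith)

/-- `(1+ε₀)^{5/2} ≤ 8`. (parameter bookkeeping of the hierarchy
`1 ≪ 1/ε₀ ≪ K ≪ 1/ε ≪ n₀` of §6.1). [cite: Tao2016AveragedNS, §6.1] -/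
theorem Context.q52_le (cx : Context ε₀ K ε C₁ C₂ C₃ C₄ C₅ n₀ N ηp βp τ Y W F T ζ) :
    (1 + ε₀) ^ ((5 : ℝ) / 2) ≤ 8 := by
  calc (1 + ε₀) ^ ((5 : ℝ) / 2) ≤ (2 : ℝ) ^ ((5 : ℝ) / 2) := cx.q_rpow_le (by norm_num)
    _ ≤ (2 : ℝ) ^ ((3 : ℕ) : ℝ) := Real.rpow_le_rpow_of_exponent_le (by norm_num) (by norm_num)
    _ = 8 := by rw [Real.rpow_natCast]; norm_num

/-- `1 ≤ (1+ε₀)^{5/2}`. (parameter bookkeeping of the hierarchy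
`1 ≪ 1/ε₀ ≪ K ≪ 1/ε ≪ n₀` of §6.1). [cite: Tao2016AveragedNS, §6.1] -/
theorem Context.one_le_q52 (cx : Context ε₀ K ε C₁ C₂ C₃ C₄ C₅ n₀ N ηp βp τ Y W F T ζ) :
    1 ≤ (1 + ε₀) ^ ((5 : ℝ) / 2) := cx.one_le_q_rpow (by norm_num)

/-- `1/8 ≤ (1+ε₀)^{-5/2} ≤ 1`. (parameter bookkeeping of the hierarchy
`1 ≪ 1/ε₀ ≪ K ≪ 1/ε ≪ n₀` of §6.1). [cite: Tao2016AveragedNS, §6.1] -/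
theorem Context.qm52_le (cx : Context ε₀ K ε C₁ C₂ C₃ C₄ C₅ n₀ N ηp βp τ Y W F T ζ) :
    (1 + ε₀) ^ (-(5 : ℝ) / 2) ≤ 1 := cx.q_rpow_le_one (by norm_num)

/-- `1/8 ≤ (1+ε₀)^{-5/2}`. (parameter bookkeeping of the hierarchy
`1 ≪ 1/ε₀ ≪ K ≪ 1/ε ≪ n₀` of §6.1). [cite: Tao2016AveragedNS, §6.1] -/
theorem Context.qm52_ge (cx : Context ε₀ K ε C₁ C₂ C₃ C₄ C₅ n₀ N ηp βp τ Y W F T ζ) :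
    1 / 8 ≤ (1 + ε₀) ^ (-(5 : ℝ) / 2) := by
  rw [show -(5 : ℝ) / 2 = -((5 : ℝ) / 2) by ring, Real.rpow_neg cx.q_pos.le, one_div]
  exact inv_anti₀ (Real.rpow_pos_of_pos cx.q_pos _) cx.q52_le

/-- `K^{-1/4} ≤ 1`. (parameter bookkeeping of the hierarchy
`1 ≪ 1/ε₀ ≪ K ≪ 1/ε ≪ n₀` of §6.1). [cite: Tao2016AveragedNS, §6.1] -/
theorem Context.K_rpow_neg_quarter_le (cx : Context ε₀ K ε C₁ C₂ C₃ C₄ C₅ n₀ N ηp βp τ Y W F T ζ) :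
    K ^ (-(1 : ℝ) / 4) ≤ 1 :=
  Real.rpow_le_one_of_one_le_of_nonpos cx.one_le_K (by norm_num)

/-- **(6.133)**: `|∂ₜa₁ - (1+ε₀)^{5/2} K d₀²| ≤ 16 C₄ ε² |a₁| + 4 C₄ e^{-K¹⁰/2} K⁻¹⁰ + 4 C₁ (1+ε₀)^{-n₀/2}`
on `[0, T]` (the printed `O(K⁻¹|a₁|) + O(K⁻²⁰)`). [cite: Tao2016AveragedNS, §6.6 (6.133)] -/
theorem Context.da_one (cx : Context ε₀ K ε C₁ C₂ C₃ C₄ C₅ n₀ N ηp βp τ Y W F T ζ) {t : ℝ}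
    (ht : t ∈ Icc 0 T) :
    |dY (τ (n₀ - N)) Y 0 1 t - (1 + ε₀) ^ ((5 : ℝ) / 2) * K * Y 3 0 t ^ 2| ≤
      16 * C₄ * ε ^ 2 * |Y 0 1 t| + 4 * C₄ * Real.exp (-K ^ 10 / 2) * (K ^ 10)⁻¹ +
        4 * C₁ * (1 + ε₀) ^ (-(n₀ : ℝ) / 2) := by
  have h := cx.hyp.eq_a_one cx.ε_pos cx.K_pos.le cx.C₁_half_nn (by linarith [cx.ε₀_pos])
    (cx.τ₀_le.trans ht.1) (cx.F_one_le_one ht) (cx.small.b_one t ht) (cx.small.c_one t ht)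
    ((cx.loc t ht).d_le) (cx.absW_one_le 1 ht) (cx.absW_one_le 2 ht) (cx.absW_zero_le 2 ht)
  refine h.trans ?_
  have hbud := cx.asym_budget.2.2.2.1
  have hq := cx.q52_le
  have hq0 : 0 ≤ (1 + ε₀) ^ ((5 : ℝ) / 2) := Real.rpow_nonneg cx.q_pos.le _
  have hε := cx.ε_pos
  have hε1 := cx.ε_le
  have hK := cx.K_pos
  have hC₄ := cx.C₄_nn
  have hC₁ := cx.C₁_nn
  have hKq := cx.K_rpow_neg_quarter_le
  have hKq0 : 0 ≤ K ^ (-(1 : ℝ) / 4) := Real.rpow_nonneg hK.le _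
  have hexp1 : Real.exp (-K ^ 10) ≤ 1 := by
    rw [Real.exp_le_one_iff]; have := pow_nonneg hK.le 10; linarith
  have hexp2 : Real.exp (-K ^ 10 / 2) ≤ 1 := by
    rw [Real.exp_le_one_iff]; have := pow_nonneg hK.le 10; linarith
  have he1 := Real.exp_pos (-K ^ 10)
  have he2 := Real.exp_pos (-K ^ 10 / 2)
  have hK10 : 0 < (K ^ 10)⁻¹ := by positivity
  have ha := abs_nonneg (Y 0 1 t)
  -- the `|a₁|` coefficient
  have h1 : (1 + ε₀) ^ ((5 : ℝ) / 2) *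
      (ε * (C₄ * K ^ (-(1 : ℝ) / 4) * ε) + ε ^ 2 * Real.exp (-K ^ 10) *
        (C₄ * Real.exp (-K ^ 10 / 2) * ε ^ 2)) ≤ 16 * C₄ * ε ^ 2 := by
    have e1 : ε * (C₄ * K ^ (-(1 : ℝ) / 4) * ε) ≤ C₄ * ε ^ 2 := by
      calc ε * (C₄ * K ^ (-(1 : ℝ) / 4) * ε) = C₄ * ε ^ 2 * K ^ (-(1 : ℝ) / 4) := by ring
        _ ≤ C₄ * ε ^ 2 * 1 := by gcongr
        _ = _ := mul_one _
    have e2 : ε ^ 2 * Real.exp (-K ^ 10) * (C₄ * Real.exp (-K ^ 10 / 2) * ε ^ 2) ≤ C₄ * ε ^ 2 := by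
      calc ε ^ 2 * Real.exp (-K ^ 10) * (C₄ * Real.exp (-K ^ 10 / 2) * ε ^ 2)
          = C₄ * ε ^ 2 * (Real.exp (-K ^ 10) * Real.exp (-K ^ 10 / 2) * ε ^ 2) := by ring
        _ ≤ C₄ * ε ^ 2 * (1 * 1 * 1 ^ 2) := by gcongr
        _ = _ := by ring
    calc (1 + ε₀) ^ ((5 : ℝ) / 2) * (ε * (C₄ * K ^ (-(1 : ℝ) / 4) * ε) +
          ε ^ 2 * Real.exp (-K ^ 10) * (C₄ * Real.exp (-K ^ 10 / 2) * ε ^ 2))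
        ≤ 8 * (C₄ * ε ^ 2 + C₄ * ε ^ 2) :=
          mul_le_mul hq (add_le_add e1 e2) (by positivity) (by norm_num)
      _ = 16 * C₄ * ε ^ 2 := by ring
  -- the constant term
  have h2 : (1 + ε₀) ^ ((5 : ℝ) / 2) * (ε ^ 2)⁻¹ * (C₄ * Real.exp (-K ^ 10 / 2) * ε ^ 2) *
      (1 / 2 * (K ^ 10)⁻¹) ≤ 4 * C₄ * Real.exp (-K ^ 10 / 2) * (K ^ 10)⁻¹ := by
    have : (1 + ε₀) ^ ((5 : ℝ) / 2) * (ε ^ 2)⁻¹ * (C₄ * Real.exp (-K ^ 10 / 2) * ε ^ 2) *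
        (1 / 2 * (K ^ 10)⁻¹) =
        (1 + ε₀) ^ ((5 : ℝ) / 2) * (1 / 2) * (C₄ * Real.exp (-K ^ 10 / 2) * (K ^ 10)⁻¹) := by
      field_simp
    rw [this]
    calc (1 + ε₀) ^ ((5 : ℝ) / 2) * (1 / 2) * (C₄ * Real.exp (-K ^ 10 / 2) * (K ^ 10)⁻¹)
        ≤ 8 * (1 / 2) * (C₄ * Real.exp (-K ^ 10 / 2) * (K ^ 10)⁻¹) := by gcongr
      _ = _ := by ring
  have h3 : C₁ / 2 * (1 + ε₀) ^ (2 - (n₀ : ℝ) / 2) ≤ 2 * C₁ * (1 + ε₀) ^ (-(n₀ : ℝ) / 2) := by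
    have e : (1 + ε₀) ^ (2 - (n₀ : ℝ) / 2) = (1 + ε₀) ^ (2 : ℝ) * (1 + ε₀) ^ (-(n₀ : ℝ) / 2) := by
      rw [← Real.rpow_add cx.q_pos]; congr 1; ring
    have h4 : (1 + ε₀) ^ (2 : ℝ) ≤ 4 := by
      rw [show (2 : ℝ) = ((2 : ℕ) : ℝ) by norm_num, Real.rpow_natCast]
      nlinarith [cx.q_lt_two, cx.q_pos]
    have h0 : 0 ≤ (1 + ε₀) ^ (-(n₀ : ℝ) / 2) := Real.rpow_nonneg cx.q_pos.le _
    have hC := cx.C₁_half_nn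
    rw [e]
    calc C₁ / 2 * ((1 + ε₀) ^ (2 : ℝ) * (1 + ε₀) ^ (-(n₀ : ℝ) / 2))
        ≤ C₁ / 2 * (4 * (1 + ε₀) ^ (-(n₀ : ℝ) / 2)) := by gcongr
      _ = _ := by ring
  -- the asymmetry corrections `(1+ε₀)^{5/2}(ε⁻²ζ² + Kζ²) ≤ 8(ε⁻² + K)ζ² ≤ (C₁/2)(1+ε₀)^{-n₀/2}`
  have h5 : (1 + ε₀) ^ ((5 : ℝ) / 2) * ((ε ^ 2)⁻¹ * ζ ^ 2 + K * ζ ^ 2) ≤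
      C₁ / 2 * (1 + ε₀) ^ (-(n₀ : ℝ) / 2) := by
    have hz : 0 ≤ (ε ^ 2)⁻¹ * ζ ^ 2 + K * ζ ^ 2 := by positivity
    calc (1 + ε₀) ^ ((5 : ℝ) / 2) * ((ε ^ 2)⁻¹ * ζ ^ 2 + K * ζ ^ 2)
        ≤ 8 * ((ε ^ 2)⁻¹ * ζ ^ 2 + K * ζ ^ 2) := mul_le_mul_of_nonneg_right hq hz
      _ = 8 * ((ε ^ 2)⁻¹ + K) * ζ ^ 2 := by ring
      _ ≤ _ := hbud
  have hρ0 : 0 ≤ C₁ * (1 + ε₀) ^ (-(n₀ : ℝ) / 2) :=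
    mul_nonneg hC₁ (Real.rpow_nonneg cx.q_pos.le _)
  nlinarith [mul_le_mul_of_nonneg_right h1 ha]

/-- **(6.49♯) at `k = 0`, raw form**: `∂ₜẼ₀ ≤ K ((d̃₋₁² - Z̃²_{d,-1}) ã₀ - (1+ε₀)^{5/2} (d̃₀² - Z̃²_{d,0}) ã₁)`
(valid at every `t ≥ τ_{n₀-N}`). [cite: Tao2016AveragedNS, §6.4 (6.49)] -/
theorem Context.dF_zero_raw (cx : Context ε₀ K ε C₁ C₂ C₃ C₄ C₅ n₀ N ηp βp τ Y W F T ζ) {t : ℝ}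
    (ht : τ (n₀ - N) ≤ t) :
    dF (τ (n₀ - N)) F 0 t ≤
      K * ((Y 3 (-1) t ^ 2 - W 2 (-1) t ^ 2) * Y 0 0 t -
        (1 + ε₀) ^ ((5 : ℝ) / 2) * (Y 3 0 t ^ 2 - W 2 0 t ^ 2) * Y 0 1 t) := by
  have h := cx.hyp.energy 0 t ht
  simp only [Int.cast_zero, mul_zero, zero_div, Real.rpow_zero, mul_one, zero_sub,
    zero_add] at h
  exact h

/-- **(6.49♯) at `k = 0` on the window, Tao's form up to the absorbed asymmetry**:
`∂ₜẼ₀ ≤ K (d̃₋₁² ã₀ - (1+ε₀)^{5/2} d̃₀² ã₁) + C₁ (1+ε₀)^{-n₀/2}` on `[0, T]` (the two-way corrections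
`K Z̃²_{d,-1}|ã₀| + (1+ε₀)^{5/2} K Z̃²_{d,0}|ã₁| ≤ 14Kζ²` are inside the master budget).
[cite: Tao2016AveragedNS, §6.4 (6.49)] -/
theorem Context.dF_zero (cx : Context ε₀ K ε C₁ C₂ C₃ C₄ C₅ n₀ N ηp βp τ Y W F T ζ) {t : ℝ}
    (ht : t ∈ Icc 0 T) :
    dF (τ (n₀ - N)) F 0 t ≤
      K * (Y 3 (-1) t ^ 2 * Y 0 0 t - (1 + ε₀) ^ ((5 : ℝ) / 2) * Y 3 0 t ^ 2 * Y 0 1 t) +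
        C₁ * (1 + ε₀) ^ (-(n₀ : ℝ) / 2) := by
  have h := cx.dF_zero_raw (cx.τ₀_le.trans ht.1)
  have hK := cx.K_pos
  have hq := cx.q52_le
  have hq0 : 0 ≤ (1 + ε₀) ^ ((5 : ℝ) / 2) := Real.rpow_nonneg cx.q_pos.le _
  have ha0 := cx.abs_Y_zero_le 0 ht
  have ha1 := cx.abs_Y_one_le 0 ht
  have hw1 := cx.absW_negOne_le 2 ht
  have hw0 := cx.absW_zero_le 2 ht
  have hbud := cx.asym_budget.2.2.2.2
  have hC := cx.C₁_half_nn
  have hρ : 0 ≤ (1 + ε₀) ^ (-(n₀ : ℝ) / 2) := Real.rpow_nonneg cx.q_pos.le _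
  have hw1sq : W 2 (-1) t ^ 2 ≤ ζ ^ 2 := by
    rw [← sq_abs]; exact pow_le_pow_left₀ (abs_nonneg _) hw1 2
  have hw0sq : W 2 0 t ^ 2 ≤ ζ ^ 2 := by
    rw [← sq_abs]; exact pow_le_pow_left₀ (abs_nonneg _) hw0 2
  -- the two correction terms
  have t1 : K * (W 2 (-1) t ^ 2 * Y 0 0 t) ≤ K * (ζ ^ 2 * (3 / 2)) := by
    apply mul_le_mul_of_nonneg_left _ hK.le
    calc W 2 (-1) t ^ 2 * Y 0 0 t ≤ W 2 (-1) t ^ 2 * |Y 0 0 t| :=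
          mul_le_mul_of_nonneg_left (le_abs_self _) (sq_nonneg _)
      _ ≤ ζ ^ 2 * (3 / 2) := mul_le_mul hw1sq ha0 (abs_nonneg _) (sq_nonneg _)
  have t2 : K * ((1 + ε₀) ^ ((5 : ℝ) / 2) * (W 2 0 t ^ 2 * Y 0 1 t)) ≤ K * (8 * (ζ ^ 2 * (3 / 2))) := by
    apply mul_le_mul_of_nonneg_left _ hK.le
    have : W 2 0 t ^ 2 * Y 0 1 t ≤ ζ ^ 2 * (3 / 2) :=
      calc W 2 0 t ^ 2 * Y 0 1 t ≤ W 2 0 t ^ 2 * |Y 0 1 t| :=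
            mul_le_mul_of_nonneg_left (le_abs_self _) (sq_nonneg _)
        _ ≤ ζ ^ 2 * (3 / 2) := mul_le_mul hw0sq ha1 (abs_nonneg _) (sq_nonneg _)
    calc (1 + ε₀) ^ ((5 : ℝ) / 2) * (W 2 0 t ^ 2 * Y 0 1 t)
        ≤ (1 + ε₀) ^ ((5 : ℝ) / 2) * (ζ ^ 2 * (3 / 2)) := mul_le_mul_of_nonneg_left this hq0
      _ ≤ 8 * (ζ ^ 2 * (3 / 2)) := mul_le_mul_of_nonneg_right hq (by positivity)
  have e : K * ((Y 3 (-1) t ^ 2 - W 2 (-1) t ^ 2) * Y 0 0 t -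
        (1 + ε₀) ^ ((5 : ℝ) / 2) * (Y 3 0 t ^ 2 - W 2 0 t ^ 2) * Y 0 1 t) =
      K * (Y 3 (-1) t ^ 2 * Y 0 0 t - (1 + ε₀) ^ ((5 : ℝ) / 2) * Y 3 0 t ^ 2 * Y 0 1 t) -
        K * (W 2 (-1) t ^ 2 * Y 0 0 t) +
        K * ((1 + ε₀) ^ ((5 : ℝ) / 2) * (W 2 0 t ^ 2 * Y 0 1 t)) := by ring
  rw [e] at h
  -- `-K W²a₀ ≤ K ζ² 3/2` as well (|a₀| bound)
  have t1' : -(K * (W 2 (-1) t ^ 2 * Y 0 0 t)) ≤ K * (ζ ^ 2 * (3 / 2)) := by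
    rw [← mul_neg]
    apply mul_le_mul_of_nonneg_left _ hK.le
    calc -(W 2 (-1) t ^ 2 * Y 0 0 t) = W 2 (-1) t ^ 2 * (-Y 0 0 t) := by ring
      _ ≤ W 2 (-1) t ^ 2 * |Y 0 0 t| :=
          mul_le_mul_of_nonneg_left (neg_le_abs _) (sq_nonneg _)
      _ ≤ ζ ^ 2 * (3 / 2) := mul_le_mul hw1sq ha0 (abs_nonneg _) (sq_nonneg _)
  nlinarith

/-- **(6.49♯) at `k = -1`, raw form**: `∂ₜẼ₋₁ ≤ K (1+ε₀)^{-5/2} ((d̃₋₂² - Z̃²_{d,-2}) ã₋₁ -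
(1+ε₀)^{5/2} (d̃₋₁² - Z̃²_{d,-1}) ã₀)`. [cite: Tao2016AveragedNS, §6.4 (6.49)] -/
theorem Context.dF_negOne_raw (cx : Context ε₀ K ε C₁ C₂ C₃ C₄ C₅ n₀ N ηp βp τ Y W F T ζ) {t : ℝ}
    (ht : τ (n₀ - N) ≤ t) :
    dF (τ (n₀ - N)) F (-1) t ≤
      K * (1 + ε₀) ^ (-(5 : ℝ) / 2) *
        ((Y 3 (-2) t ^ 2 - W 2 (-2) t ^ 2) * Y 0 (-1) t -
          (1 + ε₀) ^ ((5 : ℝ) / 2) * (Y 3 (-1) t ^ 2 - W 2 (-1) t ^ 2) * Y 0 0 t) := by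
  have h := cx.hyp.energy (-1) t ht
  have e1 : (5 : ℝ) * ((-1 : ℤ) : ℝ) / 2 = -(5 : ℝ) / 2 := by push_cast; ring
  have e2 : (-1 : ℤ) - 1 = -2 := by norm_num
  have e3 : (-1 : ℤ) + 1 = 0 := by norm_num
  rw [e1, e2, e3] at h
  exact h

/-- The two-way pump from scale `-2` is bounded by the energy: `|d̃₋₂² - Z̃²_{d,-2}| ≤ 4K⁻¹⁰` on
`[0, T]`. [cite: Tao2016AveragedNS, §6.7] -/
theorem Context.absP_negTwo_le (cx : Context ε₀ K ε C₁ C₂ C₃ C₄ C₅ n₀ N ηp βp τ Y W F T ζ) {t : ℝ}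
    (ht : t ∈ Icc 0 T) : |Y 3 (-2) t ^ 2 - W 2 (-2) t ^ 2| ≤ 4 * (K ^ 10)⁻¹ := by
  have h := cx.hyp.abs_sq_sub_sqW_le_two_mul_energy (-2) (cx.τ₀_le.trans ht.1)
  have hF := cx.F_negTwo_le ht
  linarith

/-- **(6.49♯) at `k = -1` on the window, Tao's form up to the absorbed asymmetry and with the pump
from scale `-2` as a two-way pump `P₋₂ = d̃₋₂² - Z̃²_{d,-2}` (`|P₋₂| ≤ 4K⁻¹⁰`, `absP_negTwo_le`)**:
`∂ₜẼ₋₁ ≤ K(1+ε₀)^{-5/2} P₋₂ ã₋₁ - K d̃₋₁² ã₀ + C₁(1+ε₀)^{-n₀/2}`. [cite: Tao2016AveragedNS, §6.4 (6.49)] -/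
theorem Context.dF_negOne (cx : Context ε₀ K ε C₁ C₂ C₃ C₄ C₅ n₀ N ηp βp τ Y W F T ζ) {t : ℝ}
    (ht : t ∈ Icc 0 T) :
    dF (τ (n₀ - N)) F (-1) t ≤
      K * (1 + ε₀) ^ (-(5 : ℝ) / 2) * ((Y 3 (-2) t ^ 2 - W 2 (-2) t ^ 2) * Y 0 (-1) t) -
        K * Y 3 (-1) t ^ 2 * Y 0 0 t + C₁ * (1 + ε₀) ^ (-(n₀ : ℝ) / 2) := by
  have h := cx.dF_negOne_raw (cx.τ₀_le.trans ht.1)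
  have hK := cx.K_pos
  have h0 : (0 : ℝ) < 1 + ε₀ := cx.q_pos
  have hcancel : (1 + ε₀) ^ (-(5 : ℝ) / 2) * (1 + ε₀) ^ ((5 : ℝ) / 2) = 1 := by
    rw [← Real.rpow_add h0]; norm_num
  have ha0 := cx.abs_Y_zero_le 0 ht
  have hw1 := cx.absW_negOne_le 2 ht
  have hbud := cx.asym_budget.2.2.2.2
  have hC := cx.C₁_half_nn
  have hρ : 0 ≤ (1 + ε₀) ^ (-(n₀ : ℝ) / 2) := Real.rpow_nonneg h0.le _
  have hw1sq : W 2 (-1) t ^ 2 ≤ ζ ^ 2 := by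
    rw [← sq_abs]; exact pow_le_pow_left₀ (abs_nonneg _) hw1 2
  have e : K * (1 + ε₀) ^ (-(5 : ℝ) / 2) *
        ((Y 3 (-2) t ^ 2 - W 2 (-2) t ^ 2) * Y 0 (-1) t -
          (1 + ε₀) ^ ((5 : ℝ) / 2) * (Y 3 (-1) t ^ 2 - W 2 (-1) t ^ 2) * Y 0 0 t) =
      K * (1 + ε₀) ^ (-(5 : ℝ) / 2) * ((Y 3 (-2) t ^ 2 - W 2 (-2) t ^ 2) * Y 0 (-1) t) -
        ((1 + ε₀) ^ (-(5 : ℝ) / 2) * (1 + ε₀) ^ ((5 : ℝ) / 2)) * (K * Y 3 (-1) t ^ 2 * Y 0 0 t) +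
        ((1 + ε₀) ^ (-(5 : ℝ) / 2) * (1 + ε₀) ^ ((5 : ℝ) / 2)) * (K * (W 2 (-1) t ^ 2 * Y 0 0 t)) := by
    ring
  rw [e, hcancel, one_mul, one_mul] at h
  have t1 : K * (W 2 (-1) t ^ 2 * Y 0 0 t) ≤ K * (ζ ^ 2 * (3 / 2)) := by
    apply mul_le_mul_of_nonneg_left _ hK.le
    calc W 2 (-1) t ^ 2 * Y 0 0 t ≤ W 2 (-1) t ^ 2 * |Y 0 0 t| :=
          mul_le_mul_of_nonneg_left (le_abs_self _) (sq_nonneg _)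
      _ ≤ ζ ^ 2 * (3 / 2) := mul_le_mul hw1sq ha0 (abs_nonneg _) (sq_nonneg _)
  nlinarith

end Basic

end ZeroScale

end Tao2016AveragedNS

end Literature.Analysis.FluidPDE
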